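import Literature.AlgebraicGeometry.Resolution.HilbertSamuelSemicontinuitySharp
import HarnessLib

/-!
# `SigmaMaxModifications` (crux stmt-ResolutionOfSingularities-18506, line `Sketch`):
# stub `stub_hsFun_le_of_specializes_over_field` — CJS Thm. 2.33 (1) SHARP over a field

Stub `stub_hsFun_le_of_specializes_over_field` of the lead skeleton `Sketch` (reshape 3) for the
crux `Summit.ResolutionOfSingularities.ResolutionOfSingularities.Theses.HilbertSamuelElimination.SigmaMaxModifications`
(Cossart–Jannsen–Saito, LNM 2270, Def. 6.15: `Σ^max`-modifications at every level `N ≥ dim X`).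
For `X` locally of finite type over a field `k`, `y ⤳ x` and `N ≥ ψ_X(x)`:
`H^N_X(y) ≤ H^N_X(x)` — the sharp form of Thm. 2.33 (1) needed at the binding level
`N = dim X` (where `φ_X(x) = 0` at closed points of top-dimensional components), which the
tree's Bennett–Hironaka rendering `Scheme.hsFun_le_hsFun_of_specializes` (`N > ψ_X(x)`) misses.

Proof. `Scheme.hsFun_le_hsFun_of_specializes_over_field`
(`Literature/AlgebraicGeometry/Resolution/HilbertSamuelSemicontinuitySharp.lean`): HIO's proof of
Thm. (30.2) (quadratic transforms along `𝔭`, finite normalization of `R/𝔭` by excellence,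
Prop. (30.1) at the regular end) run with Singh's SHARP blow-up inequality Thm. (29.1) in equal
characteristic (`PointBlowupSinghSharp.lean`) gives `H^{(s+d)}[R_𝔭] ≤ H^{(s)}[R]`
(`BennettDimOneSharp.lean`); with CJS Lemma 2.30 (1) this is Thm. 2.33 (1) at every level `N`
(the hypothesis `N ≥ ψ_X(x)` of the registered signature is not even needed).

## Sources

* V. Cossart, U. Jannsen, S. Saito, *Desingularization: Invariants and Strategy*, LNM 2270
  (2020), Thm. 2.33 (1), Lemma 2.30 (1), Def. 2.28. [CossartJannsenSaito2020]
* M. Herrmann, S. Ikeda, U. Orbanz, *Equimultiplicity and Blowing up*, Springer 1988,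
  Thm. (29.1), Thm. (30.2) (pp. 251–252). [HerrmannIkedaOrbanz1988]
-/

set_option linter.dupNamespace false -- mandated namespace of this single-conjunct summit

noncomputable section

open CategoryTheory AlgebraicGeometry TopologicalSpace Topology
open Literature.AlgebraicGeometry.Resolution Literature.RingTheory.HilbertSamuel

namespace Summit.ResolutionOfSingularities.ResolutionOfSingularities.Theorems.SigmaMaxModifications.Sketch

/-- **CJS Thm. 2.33 (1) SHARP over a field** (stub `stub_hsFun_le_of_specializes_over_field` of
line `Sketch`): for `X` locally of finite type over a field `k`, `y ⤳ x` and `N ≥ ψ_X(x)`,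
`H^N_X(y) ≤ H^N_X(x)` — by `Scheme.hsFun_le_hsFun_of_specializes_over_field` (HIO Thm. (30.2)
with Singh's sharp Thm. (29.1) in equal characteristic; the level hypothesis is not used).
[cite: CossartJannsenSaito2020, Thm. 2.33 (1)] [cite: HerrmannIkedaOrbanz1988, Thm. (30.2)] -/
theorem stub_hsFun_le_of_specializes_over_field :
    ∀ (k : Type) [Field k] (X : Scheme.{0}) (f : X ⟶ Spec (.of k)), LocallyOfFiniteType f →
      ∀ (N : ℕ) (x y : X), y ⤳ x → Scheme.hsPsi X x ≤ N →
        Scheme.hsFun X N y ≤ Scheme.hsFun X N x := by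
  intro k _ X f hf N x y h _
  haveI := hf
  exact Scheme.hsFun_le_hsFun_of_specializes_over_field f N h

end Summit.ResolutionOfSingularities.ResolutionOfSingularities.Theorems.SigmaMaxModifications.Sketch
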